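import Summits.BirchSwinnertonDyer.BirchSwinnertonDyer.Theorems.ResidualThetaTransportAtTwoThetaLayerLambdaCongruenceAtTwoIpOfTransposeAdjoint
import HarnessLib

/-!
# Crux Kan⁺ `ThetaLayerLambdaCongruenceAtTwo` (stmt-BirchSwinnertonDyer-20688), line `birth` v14, SD floor, Hecke clause — `T♯_p = T_p` for
# `p ∤ N`, and IP from the SPLIT output shapes (HA-T) + (HA-U) of `Lines/birth-sd2-hecke-adjoint.md`
# (width seat bsd-wall-rtt-p3-w4 g7; `--supports stmt-BirchSwinnertonDyer-20688`; THEOREMS ONLY — no `def`, no named fact, no `sorry`)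

HONEST FRAMING. Theorems about the tree's Hecke / Fricke operators on `S₂(Γ₀(N))`, its dual, and `Λ = periodHomologyHecke N`; nothing here
settles Kan⁺; BSD is not proved by any of this.

WHAT. (1) `transposeHeckeT_apply_eq_heckeT_of_coprime`: for `gcd(p, N) = 1` the transposed double-coset operator
`T♯_p = [Γ₀(N) diag(p,1) Γ₀(N)]` EQUALS `T_p = [Γ₀(N) diag(1,p) Γ₀(N)]` on `S₂(Γ₀(N))` (weight `2`): `T♯_p = w T_p w`
(`frickeInvolution_heckeT_frickeInvolution`, Diamond–Shurman Ex. 5.5.1), `w T_p = T_p w` for `p ∤ N` (`frickeInvolution_heckeT`, Atkin–Lehner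
Lemma 11) and `w² = 1` (`frickeInvolution_frickeInvolution_holds`); dual and `Λ`-versions (`coe_heckeT_smul_eq_dualMap_transposeHeckeT_of_not_dvd`:
for `p ∤ N` the element `y' := T_p • y` of `Λ` underlies `T♯_p^∨ y`). (2) `exists_perfect_balanced_of_selfAdjoint_transposeAdjoint`: IP at level
`N` from a bijective `B` that is SELF-adjoint for `T_p`, `p ∤ N` (HA-T) and TRANSPOSE-adjoint for `U_q`, `q ∣ N` (HA-U) — the literal two
output shapes of rtt-p3-w3 g11's bricks — by `exists_perfect_balanced_of_transposeAdjoint` (p656381); all-levels wrapper `ip_of_selfAdjoint_transposeAdjoint`. (3) The FLIPPED architecture (lead g13, 18:40Z «flip»: `T♯_p` on the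
dual-chain slot, `T_p` on the Manin-chain slot, so that rtt-p3-w2 g8's `flatMap_reexpansion_isManinChain` with upper-triangular reps applies):
`exists_perfect_balanced_of_flippedTwistedAdjoint` (`B'' := B(w ·, ·)`), `exists_perfect_balanced_of_flippedTransposeAdjoint`(`_periodFunctional`),
`ip_of_crossingPairing_flippedTransposeAdjoint`, `ip_of_flippedTransposeAdjoint`, `thetaLayerLambdaCongruenceAtTwo_of_flippedTransposeAdjoint_bz`.

References: F. Diamond, J. Shurman (2005) Ex. 5.5.1, Thm. 5.5.3 [DiamondShurman2005]; A. O. L. Atkin, J. Lehner (1970) Lemma 11 [AtkinLehner1970];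
L. Merel (1995) §2.1–2.3 [Merel1995Homologie].
-/

set_option autoImplicit false
-- justification: the `Summit.BirchSwinnertonDyer.BirchSwinnertonDyer.…` path repeats a component (route-file convention)
set_option linter.dupNamespace false

noncomputable section

open scoped MatrixGroups ModularForm

open CongruenceSubgroup
open Literature.NumberTheory.EllipticCurves Literature.NumberTheory.EllipticCurves.ModularForms

namespace Summit.BirchSwinnertonDyer.BirchSwinnertonDyer.Theorems.ThetaLayerLambdaCongruenceAtTwo

section Coprime

variable (N : ℕ) [NeZero N]

/-- **`T♯_p = T_p` on `S₂(Γ₀(N))` for `gcd(p, N) = 1`**: `[Γ₀(N) diag(p,1) Γ₀(N)] g = T_p g` (`T♯_p = w T_p w = T_p w w = T_p` in weight `2`).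
[cite: DiamondShurman2005, Ex. 5.5.1 and Thm. 5.5.3] [cite: AtkinLehner1970, Lemma 11] -/
theorem transposeHeckeT_apply_eq_heckeT_of_coprime (p : ℕ) [NeZero p] (hpN : p.Coprime N) (g : CuspForm (Gamma0 N) 2) :
    cuspHeckeOperatorₗ (Gamma0 N) 2 (diagGL p 1 (Nat.cast_pos.mpr (NeZero.pos p)) one_pos) g = heckeT (Gamma0 N) 2 p g := by
  have h := frickeInvolution_heckeT_frickeInvolution N 2 p g
  rw [frickeInvolution_heckeT N 2 p hpN, frickeInvolution_frickeInvolution_holds N 2 g, map_smul, zpow_two, neg_one_mul,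
    neg_neg, one_smul, one_smul] at h
  exact h.symm

/-- **`T♯_p^∨ = T_p^∨` on `S₂(Γ₀(N))^∨` for `gcd(p, N) = 1`.** [cite: DiamondShurman2005, Ex. 5.5.1 and Thm. 5.5.3] -/
theorem dualMap_transposeHeckeT_eq_dualMap_heckeT_of_coprime (p : ℕ) [NeZero p] (hpN : p.Coprime N)
    (φ : Module.Dual ℂ (CuspForm (Gamma0 N) 2)) :
    (cuspHeckeOperatorₗ (Gamma0 N) 2 (diagGL p 1 (Nat.cast_pos.mpr (NeZero.pos p)) one_pos)).dualMap φ =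
      (heckeT (Gamma0 N) 2 p).dualMap φ := by
  ext g
  simp only [LinearMap.dualMap_apply]
  rw [transposeHeckeT_apply_eq_heckeT_of_coprime N p hpN g]

/-- **For `p ∤ N`, `T_p • y` underlies `T♯_p^∨ y` on `Λ = periodHomologyHecke N`** — so in the transpose-adjointness hypothesis of
`exists_perfect_balanced_of_transposeAdjoint` the witness `y'` at a prime `p ∤ N` may be taken to be `T_p • y`.
[cite: DiamondShurman2005, Ex. 5.5.1 and Thm. 5.5.3] -/
theorem coe_heckeT_smul_eq_dualMap_transposeHeckeT_of_not_dvd (p : ℕ) (hp : p.Prime) (hpN : ¬ p ∣ N) (y : periodHomologyHecke N) :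
    ((HeckeRing0.T N 2 p hp • y : periodHomologyHecke N) : Module.Dual ℂ (CuspForm (Gamma0 N) 2)) =
      (haveI : NeZero p := ⟨hp.ne_zero⟩;
        (cuspHeckeOperatorₗ (Gamma0 N) 2 (diagGL p 1 (Nat.cast_pos.mpr (NeZero.pos p)) one_pos)).dualMap
          (y : Module.Dual ℂ (CuspForm (Gamma0 N) 2))) := by
  haveI : NeZero p := ⟨hp.ne_zero⟩
  rw [Submodule.coe_smul, SdTorsion.heckeRing0_T_smul_eq_dualMap,
    dualMap_transposeHeckeT_eq_dualMap_heckeT_of_coprime N p ((Nat.Prime.coprime_iff_not_dvd hp).mpr hpN)]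

end Coprime

section Split

variable {N : ℕ} [NeZero N]

/-- **IP at level `N` from the SPLIT shapes (HA-T) + (HA-U).** `B : Λ → Hom(Λ, ℤ)` bi-additive and bijective; (HA-T) for primes `p ∤ N`,
`B (T_p • x) y = B x (T_p • y)`; (HA-U) for primes `q ∣ N` and every `y' ∈ Λ` underlying `T♯_q^∨ y = [Γ₀(N) diag(q,1) Γ₀(N)]^∨ y`,
`B (U_q • x) y = B x y'`. Then some bijective `B'` (namely `B(·, w ·)`) is `𝕋_ℤ`-balanced: IP holds at level `N`
(`exists_perfect_balanced_of_transposeAdjoint` with `y' := T_p • y` at `p ∤ N`, `coe_heckeT_smul_eq_dualMap_transposeHeckeT_of_not_dvd`).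
[cite: Merel1995Homologie, §2.1–2.3] [cite: DiamondShurman2005, Ex. 5.5.1] -/
theorem exists_perfect_balanced_of_selfAdjoint_transposeAdjoint
    (B : periodHomologyHecke N →+ (periodHomologyHecke N →+ ℤ)) (hB : Function.Bijective B)
    (hT : ∀ (p : ℕ) (hp : p.Prime), ¬ p ∣ N → ∀ x y : periodHomologyHecke N,
      B (HeckeRing0.T N 2 p hp • x) y = B x (HeckeRing0.T N 2 p hp • y))
    (hU : ∀ (q : ℕ) (hq : q.Prime), q ∣ N → ∀ x y y' : periodHomologyHecke N,
      ((y' : periodHomologyHecke N) : Module.Dual ℂ (CuspForm (Gamma0 N) 2)) =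
        (haveI : NeZero q := ⟨hq.ne_zero⟩;
          (cuspHeckeOperatorₗ (Gamma0 N) 2 (diagGL q 1 (Nat.cast_pos.mpr (NeZero.pos q)) one_pos)).dualMap
            (y : Module.Dual ℂ (CuspForm (Gamma0 N) 2))) →
      B (HeckeRing0.T N 2 q hq • x) y = B x y') :
    ∃ B' : periodHomologyHecke N →+ (periodHomologyHecke N →+ ℤ),
      Function.Bijective B' ∧
        ∀ (t : HeckeRing0 N 2) (x y : periodHomologyHecke N), B' (t • x) y = B' x (t • y) := by
  refine exists_perfect_balanced_of_transposeAdjoint B hB fun p hp x y y' hy' ↦ ?_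
  by_cases hpN : p ∣ N
  · exact hU p hp hpN x y y' hy'
  · have e : y' = HeckeRing0.T N 2 p hp • y :=
      Subtype.ext (hy'.trans (coe_heckeT_smul_eq_dualMap_transposeHeckeT_of_not_dvd N p hp hpN y).symm)
    rw [e]
    exact hT p hp hpN x y

/-- **IP BY NAME from (HA-T) + (HA-U) at every level.** [cite: Merel1995Homologie, §1.2–1.3 and §2.1–2.3] [cite: DiamondShurman2005, Ex. 5.5.1] -/
theorem ip_of_selfAdjoint_transposeAdjoint
    (h : ∀ (N : ℕ) [NeZero N], ∃ B : periodHomologyHecke N →+ (periodHomologyHecke N →+ ℤ), Function.Bijective B ∧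
      (∀ (p : ℕ) (hp : p.Prime), ¬ p ∣ N → ∀ x y : periodHomologyHecke N,
        B (HeckeRing0.T N 2 p hp • x) y = B x (HeckeRing0.T N 2 p hp • y)) ∧
      (∀ (q : ℕ) (hq : q.Prime), q ∣ N → ∀ x y y' : periodHomologyHecke N,
        ((y' : periodHomologyHecke N) : Module.Dual ℂ (CuspForm (Gamma0 N) 2)) =
          (haveI : NeZero q := ⟨hq.ne_zero⟩;
            (cuspHeckeOperatorₗ (Gamma0 N) 2 (diagGL q 1 (Nat.cast_pos.mpr (NeZero.pos q)) one_pos)).dualMap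
              (y : Module.Dual ℂ (CuspForm (Gamma0 N) 2))) →
        B (HeckeRing0.T N 2 q hq • x) y = B x y')) :
    periodHomology_exists_heckeSelfAdjoint_perfectPairing := by
  intro N _
  obtain ⟨B, hB, hT, hU⟩ := h N
  exact exists_perfect_balanced_of_selfAdjoint_transposeAdjoint B hB hT hU

/-- **Kan⁺ BY NAME from (HA-T) + (HA-U) at every level + Bz** (`thetaLayerLambdaCongruenceAtTwo_of_ipBz`). CONDITIONAL on both displayed
hypotheses; BSD is not proved by this. [cite: Buzzard2000LevelLoweringModTwo, Prop. 2.4] [cite: DarmonDiamondTaylor1995, §1.6 Lemma 1.38 and §4.5]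
[cite: Pollack2003, Prop. 6.18 (shape)] -/
theorem thetaLayerLambdaCongruenceAtTwo_of_selfAdjoint_transposeAdjoint_bz
    (h : ∀ (N : ℕ) [NeZero N], ∃ B : periodHomologyHecke N →+ (periodHomologyHecke N →+ ℤ), Function.Bijective B ∧
      (∀ (p : ℕ) (hp : p.Prime), ¬ p ∣ N → ∀ x y : periodHomologyHecke N,
        B (HeckeRing0.T N 2 p hp • x) y = B x (HeckeRing0.T N 2 p hp • y)) ∧
      (∀ (q : ℕ) (hq : q.Prime), q ∣ N → ∀ x y y' : periodHomologyHecke N,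
        ((y' : periodHomologyHecke N) : Module.Dual ℂ (CuspForm (Gamma0 N) 2)) =
          (haveI : NeZero q := ⟨hq.ne_zero⟩;
            (cuspHeckeOperatorₗ (Gamma0 N) 2 (diagGL q 1 (Nat.cast_pos.mpr (NeZero.pos q)) one_pos)).dualMap
              (y : Module.Dual ℂ (CuspForm (Gamma0 N) 2))) →
        B (HeckeRing0.T N 2 q hq • x) y = B x y'))
    (hBz : buzzard2000_multiplicityOne_gamma0) :
    Summit.BirchSwinnertonDyer.BirchSwinnertonDyer.Theses.ResidualThetaTransportAtTwo.ThetaLayerLambdaCongruenceAtTwo :=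
  thetaLayerLambdaCongruenceAtTwo_of_ipBz (ip_of_selfAdjoint_transposeAdjoint h) hBz

end Split

/-! ## The FLIPPED architecture («flip», lead g13 18:40Z): `T♯_p` on the dual (first) slot, `T_p` on the Manin (second) slot -/

section Flip

variable {N : ℕ} [NeZero N]

/-- **Mirror assembly, twisted form.** `B` bijective, `w` an additive involution of `Λ`, and for every prime `p`
`B (w (T_p • (w x))) y = B x (T_p • y)` (the transposed operator `T♯_p = w T_p w` on the FIRST slot). Then `B'' x y := B (w x) y` is
bijective and `𝕋_ℤ`-balanced: IP at level `N`. [cite: DarmonDiamondTaylor1995, §1.6 Lemma 1.38 (p. 41)] [cite: Merel1995Homologie, §2.1–2.3] -/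
theorem exists_perfect_balanced_of_flippedTwistedAdjoint
    (B : periodHomologyHecke N →+ (periodHomologyHecke N →+ ℤ)) (hB : Function.Bijective B)
    (w : periodHomologyHecke N →+ periodHomologyHecke N) (hww : ∀ y : periodHomologyHecke N, w (w y) = y)
    (hAdj : ∀ (p : ℕ) (hp : p.Prime) (x y : periodHomologyHecke N),
      B (w (HeckeRing0.T N 2 p hp • w x)) y = B x (HeckeRing0.T N 2 p hp • y)) :
    ∃ B' : periodHomologyHecke N →+ (periodHomologyHecke N →+ ℤ),
      Function.Bijective B' ∧
        ∀ (t : HeckeRing0 N 2) (x y : periodHomologyHecke N), B' (t • x) y = B' x (t • y) := by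
  have hwbij : Function.Bijective w := Function.bijective_iff_has_inverse.mpr ⟨w, hww, hww⟩
  refine ⟨B.comp w, hB.comp hwbij, ?_⟩
  have hgen : ∀ (p : ℕ) (hp : p.Prime) (x y : periodHomologyHecke N),
      (B.comp w) (HeckeRing0.T N 2 p hp • x) y = (B.comp w) x (HeckeRing0.T N 2 p hp • y) := by
    intro p hp x y
    rw [AddMonoidHom.comp_apply, AddMonoidHom.comp_apply, ← hAdj p hp (w x) y, hww]
  exact balanced_of_balanced_T (B.comp w) hgen

/-- **Mirror assembly, transpose form («flip»).** `B` bijective and, for every prime `p` and all `x y x' ∈ Λ` with `x'` underlying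
`T♯_p^∨ x = [Γ₀(N) diag(p,1) Γ₀(N)]^∨ x`, `B x' y = B x (T_p • y)`. Then IP holds at level `N` (`w = w_N^∨` internal,
`frickeHom_heckeT_frickeHom_coe`). [cite: Merel1995Homologie, §1.2–1.3 and §2.1–2.3] [cite: DiamondShurman2005, Ex. 5.5.1] -/
theorem exists_perfect_balanced_of_flippedTransposeAdjoint
    (B : periodHomologyHecke N →+ (periodHomologyHecke N →+ ℤ)) (hB : Function.Bijective B)
    (hAdj : ∀ (p : ℕ) (hp : p.Prime) (x y x' : periodHomologyHecke N),
      ((x' : periodHomologyHecke N) : Module.Dual ℂ (CuspForm (Gamma0 N) 2)) =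
        (haveI : NeZero p := ⟨hp.ne_zero⟩;
          (cuspHeckeOperatorₗ (Gamma0 N) 2 (diagGL p 1 (Nat.cast_pos.mpr (NeZero.pos p)) one_pos)).dualMap
            (x : Module.Dual ℂ (CuspForm (Gamma0 N) 2))) →
      B x' y = B x (HeckeRing0.T N 2 p hp • y)) :
    ∃ B' : periodHomologyHecke N →+ (periodHomologyHecke N →+ ℤ),
      Function.Bijective B' ∧
        ∀ (t : HeckeRing0 N 2) (x y : periodHomologyHecke N), B' (t • x) y = B' x (t • y) := by
  obtain ⟨w, hw, hww, -⟩ := SdTorsion.exists_frickeHom_periodHomologyHecke N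
  exact exists_perfect_balanced_of_flippedTwistedAdjoint B hB w hww
    fun p hp x y ↦ hAdj p hp x y _ (frickeHom_heckeT_frickeHom_coe N w hw p hp x)

/-- **Flipped transpose-adjointness need only be checked on period functionals** (`coe_periodHomology_eq_range`).
[cite: CremonaAlgorithms1997, Lemma 2.1.1] [cite: Merel1995Homologie, §2.1–2.3] -/
theorem exists_perfect_balanced_of_flippedTransposeAdjoint_periodFunctional
    (B : periodHomologyHecke N →+ (periodHomologyHecke N →+ ℤ)) (hB : Function.Bijective B)
    (hAdj : ∀ (p : ℕ) (hp : p.Prime) (γ γ' : Gamma0 N) (x' : periodHomologyHecke N),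
      ((x' : periodHomologyHecke N) : Module.Dual ℂ (CuspForm (Gamma0 N) 2)) =
        (haveI : NeZero p := ⟨hp.ne_zero⟩;
          (cuspHeckeOperatorₗ (Gamma0 N) 2 (diagGL p 1 (Nat.cast_pos.mpr (NeZero.pos p)) one_pos)).dualMap
            (periodFunctional N γ)) →
      B x' ⟨periodFunctional N γ', periodFunctional_mem_periodHomology N γ'⟩ =
        B ⟨periodFunctional N γ, periodFunctional_mem_periodHomology N γ⟩
          (HeckeRing0.T N 2 p hp • ⟨periodFunctional N γ', periodFunctional_mem_periodHomology N γ'⟩)) :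
    ∃ B' : periodHomologyHecke N →+ (periodHomologyHecke N →+ ℤ),
      Function.Bijective B' ∧
        ∀ (t : HeckeRing0 N 2) (x y : periodHomologyHecke N), B' (t • x) y = B' x (t • y) := by
  refine exists_perfect_balanced_of_flippedTransposeAdjoint B hB fun p hp x y x' hx' ↦ ?_
  have hx : (x : Module.Dual ℂ (CuspForm (Gamma0 N) 2)) ∈ (periodHomology N : Set (Module.Dual ℂ (CuspForm (Gamma0 N) 2))) :=
    (mem_periodHomologyHecke N).mp x.2
  have hy : (y : Module.Dual ℂ (CuspForm (Gamma0 N) 2)) ∈ (periodHomology N : Set (Module.Dual ℂ (CuspForm (Gamma0 N) 2))) :=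
    (mem_periodHomologyHecke N).mp y.2
  rw [coe_periodHomology_eq_range] at hx hy
  obtain ⟨γ, hγ⟩ := hx
  obtain ⟨γ', hγ'⟩ := hy
  have ex : x = ⟨periodFunctional N γ, periodFunctional_mem_periodHomology N γ⟩ := Subtype.ext hγ.symm
  have ey : y = ⟨periodFunctional N γ', periodFunctional_mem_periodHomology N γ'⟩ := Subtype.ext hγ'.symm
  subst ex ey
  exact hAdj p hp γ γ' x' hx'

open scoped Classical in
/-- **IP BY NAME from the FLIPPED Hecke clause of the crossing pairing** (`T♯_p` on the dual-chain slot, `T_p` on the Manin-chain slot), for every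
pairing satisfying rtt-p3-w2 g8's crossing formula (copied verbatim from `exists_perfect_crossingPairing_hecke`).
[cite: Merel1995Homologie, §1.2–1.3 and §2.1–2.3] [cite: Manin1972, Thm. 1.9] -/
theorem ip_of_crossingPairing_flippedTransposeAdjoint
    (hHA : ∀ (N : ℕ) [NeZero N] (B : periodHomologyHecke N →+ (periodHomologyHecke N →+ ℤ)),
      (∀ (γ γ' : Gamma0 N) (D L : List SL(2, ℤ)),
        (∀ {A : Type} [AddCommGroup A] (G : SL(2, ℤ) → A), (∀ x, G (x * (ModularGroup.S * ModularGroup.T⁻¹)) = G x) →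
          (∀ x, G (-x) = G x) → (D.map fun h ↦ G h - G (h * ModularGroup.S)).sum = G (γ : SL(2, ℤ)) - G 1) →
        (∀ {A : Type} [AddCommGroup A] (F : SL(2, ℤ) → A), (∀ g, F (g * ModularGroup.T) = F g) → (∀ g, F (-g) = F g) →
          (L.map fun g ↦ F g - F (g * ModularGroup.S)).sum = F (γ' : SL(2, ℤ)) - F 1) →
        B ⟨periodFunctional N γ, (mem_periodHomologyHecke N).mpr (periodFunctional_mem_periodHomology N γ)⟩
          ⟨periodFunctional N γ', (mem_periodHomologyHecke N).mpr (periodFunctional_mem_periodHomology N γ')⟩ =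
          (L.map fun g ↦ (D.map fun h ↦ (Pi.single ((h⁻¹ : SL(2, ℤ)) : Gamma0Coset N) (1 : ℤ) -
            Pi.single (((h * ModularGroup.S)⁻¹ : SL(2, ℤ)) : Gamma0Coset N) 1 : Gamma0Coset N → ℤ)).sum
              ((g⁻¹ : SL(2, ℤ)) : Gamma0Coset N)).sum) →
      ∀ (p : ℕ) (hp : p.Prime) (x y x' : periodHomologyHecke N),
        ((x' : periodHomologyHecke N) : Module.Dual ℂ (CuspForm (Gamma0 N) 2)) =
          (haveI : NeZero p := ⟨hp.ne_zero⟩;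
            (cuspHeckeOperatorₗ (Gamma0 N) 2 (diagGL p 1 (Nat.cast_pos.mpr (NeZero.pos p)) one_pos)).dualMap
              (x : Module.Dual ℂ (CuspForm (Gamma0 N) 2))) →
        B x' y = B x (HeckeRing0.T N 2 p hp • y)) :
    periodHomology_exists_heckeSelfAdjoint_perfectPairing := by
  intro N _
  obtain ⟨B, hB, hcross⟩ := exists_perfect_crossingPairing_hecke (N := N)
  exact exists_perfect_balanced_of_flippedTransposeAdjoint B hB (hHA N B hcross)

/-- **IP BY NAME from flipped transpose-adjointness at every level.** [cite: Merel1995Homologie, §1.2–1.3 and §2.1–2.3] -/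
theorem ip_of_flippedTransposeAdjoint
    (h : ∀ (N : ℕ) [NeZero N], ∃ B : periodHomologyHecke N →+ (periodHomologyHecke N →+ ℤ), Function.Bijective B ∧
      ∀ (p : ℕ) (hp : p.Prime) (x y x' : periodHomologyHecke N),
        ((x' : periodHomologyHecke N) : Module.Dual ℂ (CuspForm (Gamma0 N) 2)) =
          (haveI : NeZero p := ⟨hp.ne_zero⟩;
            (cuspHeckeOperatorₗ (Gamma0 N) 2 (diagGL p 1 (Nat.cast_pos.mpr (NeZero.pos p)) one_pos)).dualMap
              (x : Module.Dual ℂ (CuspForm (Gamma0 N) 2))) →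
        B x' y = B x (HeckeRing0.T N 2 p hp • y)) :
    periodHomology_exists_heckeSelfAdjoint_perfectPairing := by
  intro N _
  obtain ⟨B, hB, hAdj⟩ := h N
  exact exists_perfect_balanced_of_flippedTransposeAdjoint B hB hAdj

/-- **Kan⁺ BY NAME from flipped transpose-adjointness at every level + Bz.** CONDITIONAL; BSD is not proved by this.
[cite: Buzzard2000LevelLoweringModTwo, Prop. 2.4] [cite: DarmonDiamondTaylor1995, §1.6 Lemma 1.38 and §4.5] [cite: Pollack2003, Prop. 6.18 (shape)] -/
theorem thetaLayerLambdaCongruenceAtTwo_of_flippedTransposeAdjoint_bz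
    (h : ∀ (N : ℕ) [NeZero N], ∃ B : periodHomologyHecke N →+ (periodHomologyHecke N →+ ℤ), Function.Bijective B ∧
      ∀ (p : ℕ) (hp : p.Prime) (x y x' : periodHomologyHecke N),
        ((x' : periodHomologyHecke N) : Module.Dual ℂ (CuspForm (Gamma0 N) 2)) =
          (haveI : NeZero p := ⟨hp.ne_zero⟩;
            (cuspHeckeOperatorₗ (Gamma0 N) 2 (diagGL p 1 (Nat.cast_pos.mpr (NeZero.pos p)) one_pos)).dualMap
              (x : Module.Dual ℂ (CuspForm (Gamma0 N) 2))) →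
        B x' y = B x (HeckeRing0.T N 2 p hp • y))
    (hBz : buzzard2000_multiplicityOne_gamma0) :
    Summit.BirchSwinnertonDyer.BirchSwinnertonDyer.Theses.ResidualThetaTransportAtTwo.ThetaLayerLambdaCongruenceAtTwo :=
  thetaLayerLambdaCongruenceAtTwo_of_ipBz (ip_of_flippedTransposeAdjoint h) hBz

end Flip

end Summit.BirchSwinnertonDyer.BirchSwinnertonDyer.Theorems.ThetaLayerLambdaCongruenceAtTwo

end
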